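import Literature.AlgebraicGeometry.HodgeTheory.GysinFormalism
import HarnessLib

/-!
# Detection of a pull-back class through a square of complex varieties and a pair of cofan legs

Topic `AlgebraicGeometry/Morphisms`; namespace `Literature.AlgebraicGeometry.Morphisms`.  PROOF FILE (theorems only — no definition,
no named fact, no instance, no `sorry`): pure functoriality of `Hⁿ(–(ℂ); ℂ)` (`HodgeTheory.complexBetti.map`, [FultonYoungTableaux1997]
App. B §B.1 (1)) on complex varieties.

THE SHAPE.  A morphism `m : A ⟶ B` of complex varieties is given together with identifications `E : B ≅ B′`, `Eₛ : A ≅ A′` and a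
morphism `ι′ : A′ ⟶ B′` making the square `m ≫ E.hom = Eₛ.hom ≫ ι′` commute (in the GS programme of the cell `hodgecm-mathlib`: `m` is
the complex base change of a morphism of Shimura towers `Sh(φ)_Λ`, `E`, `Eₛ` the bridges to the complex fibres of the canonical-model
records, `ι′` the record-level embedding); legs `ι₁ : X₁ ⟶ B′` (a connected component of the target) and `ιs : Y ⟶ A′` (one of the
source) and a lift `φ : Y ⟶ X₁` of `ι′` through them (`φ ≫ ι₁ = ιs ≫ ι′`).  If a class `x ∈ Hⁿ(B(ℂ); ℂ)` restricted to `X₁` (along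
`ι₁ ≫ E⁻¹`) pulls back NON-TRIVIALLY along `φ`, then `m^* x ≠ 0` — the class is detected on the source.  This is the bookkeeping that
turns «the special curve detects the class on the identity piece» ([Liu2021] proof of Thm. 4.15, l. 2212; tree: clause (i) of
`Model.exists_identityPiece_detectingFrame_of_omegaHom_ne_zero` with ★ `UnitaryCanonicalModel.exists_fac_pullback_ne_zero_of_rational_reps`)
into the detection hypothesis of the seesaw spine (`schemeBettiPullAlong τ′ (M.map Λ) x ≠ 0`).
[FultonYoungTableaux1997] W. Fulton, *Young Tableaux*, App. B §B.1 (1); [Liu2021] Y. Liu, Camb. J. Math. 9 (2021), Thm. 4.15 proof l. 2199–2213.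
-/

set_option autoImplicit false

noncomputable section

open CategoryTheory
open Literature.AlgebraicGeometry.HodgeTheory
open Literature.AlgebraicTopology.SingularHomology

namespace Literature.AlgebraicGeometry.Morphisms

variable {A A' B B' X₁ Y : Literature.AlgebraicGeometry.Motives.SchemeOver ℂ}

/-- **Pull-back along `m` of a class detected on a component of the source, through a commuting square and cofan legs.**
With `m ≫ E.hom = Eₛ.hom ≫ ι′` and `φ ≫ ι₁ = ιs ≫ ι′`:  `φ^* ι₁^* (E⁻¹)^* x = ιs^* (Eₛ⁻¹)^* (m^* x)` (functoriality of `Hⁿ(–(ℂ); ℂ)` and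
`ι′ ≫ E⁻¹ = Eₛ⁻¹ ≫ m`), so a non-zero left-hand side forces `m^* x ≠ 0`. [cite: FultonYoungTableaux1997, Appendix B §B.1 (1)]
[cite: Liu2021, Thm. 4.15 proof (FJcycle.tex l. 2199–2213)] -/
theorem complexBetti_map_apply_eq_of_square (m : A ⟶ B) (E : B ≅ B') (Eₛ : A ≅ A') (ι' : A' ⟶ B')
    (hsq : m ≫ E.hom = Eₛ.hom ≫ ι') (ι₁ : X₁ ⟶ B') (ιs : Y ⟶ A') (φ : Y ⟶ X₁) (hφ : φ ≫ ι₁ = ιs ≫ ι') (n : ℕ)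
    (x : complexBetti B n) :
    (complexBetti.map φ n).hom ((complexBetti.map ι₁ n).hom ((complexBetti.map E.inv n).hom x)) =
      (complexBetti.map ιs n).hom ((complexBetti.map Eₛ.inv n).hom ((complexBetti.map m n).hom x)) := by
  have hsq' : ι' ≫ E.inv = Eₛ.inv ≫ m := by
    rw [Iso.comp_inv_eq, Category.assoc, hsq, Iso.inv_hom_id_assoc]
  rw [← LinearMap.comp_apply, ← ModuleCat.hom_comp, ← complexBetti.map_comp, ← LinearMap.comp_apply, ← ModuleCat.hom_comp,
    ← complexBetti.map_comp, hφ, Category.assoc, hsq', complexBetti.map_comp, complexBetti.map_comp, ModuleCat.hom_comp,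
    ModuleCat.hom_comp, LinearMap.comp_apply, LinearMap.comp_apply]

/-- **Detection through the square**: if `φ^* (ι₁^* (E⁻¹)^* x) ≠ 0` (the lift `φ` of `ι′` through the legs detects the restricted class —
stated in the `singularCohomology.map … (AlgPoints.mapContinuous φ)` spelling of ★ `exists_fac_pullback_ne_zero_of_rational_reps`), then
`m^* x ≠ 0`. [cite: FultonYoungTableaux1997, Appendix B §B.1 (1)] [cite: Liu2021, Thm. 4.15 proof (FJcycle.tex l. 2199–2213)] -/
theorem complexBetti_map_ne_zero_of_square (m : A ⟶ B) (E : B ≅ B') (Eₛ : A ≅ A') (ι' : A' ⟶ B')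
    (hsq : m ≫ E.hom = Eₛ.hom ≫ ι') (ι₁ : X₁ ⟶ B') (ιs : Y ⟶ A') (φ : Y ⟶ X₁) (hφ : φ ≫ ι₁ = ιs ≫ ι') (n : ℕ)
    (x : complexBetti B n)
    (h : singularCohomology.map ℂ ℂ (Literature.AlgebraicGeometry.Motives.AlgPoints.mapContinuous (L := ℂ) φ) n
      ((complexBetti.map ι₁ n).hom ((complexBetti.map E.inv n).hom x)) ≠ 0) :
    (complexBetti.map m n).hom x ≠ 0 := by
  intro h0
  apply h
  change (complexBetti.map φ n).hom ((complexBetti.map ι₁ n).hom ((complexBetti.map E.inv n).hom x)) = 0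
  rw [complexBetti_map_apply_eq_of_square m E Eₛ ι' hsq ι₁ ιs φ hφ n x, h0, map_zero, map_zero]

end Literature.AlgebraicGeometry.Morphisms

end
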